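/-
Copyright: rh-split cell (screw, prover seat l19, width seat 3) gen 0, 2026-08-27.  Splitting search over
kernel-typed RH-equivalences.  A splitting `A ∧ B ⟹ RH` is CONDITIONAL bookkeeping unless `A` and `B` are
both proved; nothing here bears on the truth of RH.
-/
import Summits.RiemannHypothesis.RiemannHypothesis.Theorems.Splittings.ScrewNoPorousPoleKernel
import Summits.RiemannHypothesis.RiemannHypothesis.Theorems.Splittings.ScrewLatticeGauss
import HarnessLib

/-!
# Route X-12 `ScrewPorousWall` — the POROUS SKIN of the wall and the placement `X-9 ⊆ X-12` (RH-free)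

Objects of `ScrewLatticeContinuation` / `ScrewLatticeGauss`: a step `h`, the ALIASED POLE FIELD
`A_h = aliasedPoleSet h ⊆ 𝔻` of the far (off-line) zeros of `ζ`, its closure the WALL `T_h`, and the
origin's component `Ω₀(h) = originComponent h` of `𝔻 ∖ T_h`.  A point `p` is *`1`-porously accessible*
from `Ω₀(h)` when some sequence `z_n → p` of points of `Ω₀(h)` satisfies `‖z_n - p‖ ≤ ‖q - z_n‖` for every
wall point `q ∈ T_h` (spelled out inline; no new definition).

1. **Nearest-point geometry** (ζ-free, CEIL-free).  If `p ∈ T_h` is a nearest wall point of some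
   `w ∈ Ω₀(h)` closer to the wall than to the unit circle, then `p` is `1`-porously accessible from `Ω₀(h)`
   along the segment `[p, w]` (`exists_porous_access_of_nearest`).  Consequently (`exists_porous_wall_point`):
   **whenever `A_h ≠ ∅`, SOME point of `T_h ∩ 𝔻` is `1`-porously accessible from `Ω₀(h)`**, and such points
   are dense in the visible wall `T_h ∩ closure Ω₀(h) ∩ 𝔻` (`exists_nearest_near`).
2. **POROUS SKIN THEOREM** (RH-free, `h > 0`, under `CEIL(h) = LatticeCeiling h`;
   `infDist_lt_dist_of_mem_aliasedPoleSet`): no aliased pole is a nearest wall point of any `w ∈ Ω₀(h)` with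
   `infDist w T_h < 1 - ‖w‖` — by the ζ-free kernel of item `NoPorousPole`
   (`ScrewBorelPorous.false_of_porous_access`; the item's closer is `ScrewLatticePorous.noPorousPole_proof`)
   fed with §1 (`false_of_porous_access_closure`).  Hence (`latticeCeiling_dichotomy_skin`): **`CEIL(h) ⟹ RH ∨` [the wall has, inside `𝔻`,
   NON-POLE limit points of aliased zeros that are `1`-porously accessible from `Ω₀(h)`]**, densely along the
   visible wall (`exists_nonpole_near_of_latticeCeiling`).  This sharpens the X-12 dichotomy «no porous
   access to a pole» to «every nearest-point projection of `Ω₀(h)` onto the wall is a non-pole».  No new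
   survivor row is claimed: the matching zero-side conjunct «the visible wall consists of poles» makes the
   visible wall countable and hence implies `CC(h)` (row X-9).
3. **Placement `X-9 ⊆ X-12`** (RH-free; `exists_porous_pole_of_countableClosure`,
   `porous_pole_of_countableClosure_one`): `CC(h)` and `A_h ≠ ∅` give an aliased pole ISOLATED in the wall
   (`ScrewBorel.exists_isolated_pole`, Baire) and `Ω₀(h) = 𝔻 ∖ T_h` (`ScrewBorel.isPathConnected_ball_diff`),
   so that pole is `1`-porously accessible; at `h = 1` this gives `CountableClosure 1 → PorousPole` for the
   route decl `Theses.ScrewPorousWall.PorousPole` (stated with the decl's body VERBATIM but unfolded — the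
   open item `PorousPole` itself is NOT proved, and this file stays outside the route cone: it imports no
   `Theses` module), i.e. the companion row X-12 contains row X-9.

RH is not proved by this: X-12 `NoPorousPole ∧ PorousPole ∧ CEIL(1) ⟹ RH` stays CONDITIONAL on the open
conjuncts `PorousPole` and `CEIL(1)`; nothing here bears on the truth of RH.  No `sorry`, no new axioms, no
instances, no notation.
-/

set_option linter.dupNamespace false

namespace Summit.RiemannHypothesis.RiemannHypothesis.Theorems.Splittings.ScrewPorousSkin

open Complex Filter Topology Set Metric
open Summit.RiemannHypothesis.RiemannHypothesis.Theorems.Splittings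
open Summit.RiemannHypothesis.RiemannHypothesis.Theorems.Splittings.ScrewBorel
open Summit.RiemannHypothesis.RiemannHypothesis.Theorems.Splittings.ScrewLatticeContinuation
open Summit.RiemannHypothesis.RiemannHypothesis.Theorems.Splittings.ScrewLatticeGauss

/-! ## 1. Nearest-point geometry (ζ-free, CEIL-free) -/

/-- A real sequence in `(0, 1]` tending to `0` (namely `1/(n+1)`). -/
theorem exists_seq_tendsto_zero :
    ∃ t : ℕ → ℝ, (∀ n, 0 < t n) ∧ (∀ n, t n ≤ 1) ∧ Tendsto t atTop (𝓝 0) := by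
  refine ⟨fun n ↦ 1 / ((n : ℝ) + 1), fun n ↦ by positivity, fun n ↦ ?_,
    tendsto_one_div_add_atTop_nhds_zero_nat⟩
  rw [div_le_one (by positivity)]
  linarith [n.cast_nonneg (α := ℝ)]

/-- A real null sequence is a complex null sequence. -/
theorem tendsto_ofReal_of_tendsto_zero {t : ℕ → ℝ} (ht : Tendsto t atTop (𝓝 0)) :
    Tendsto (fun n ↦ (t n : ℂ)) atTop (𝓝 0) := by
  have h1 := Complex.continuous_ofReal.tendsto 0
  rw [Complex.ofReal_zero] at h1
  exact h1.comp ht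

/-- If `p` is a nearest point of `T` to `w` (`‖p - w‖ ≤ ‖q - w‖` for all `q ∈ T`), then every point
`z = p + t (w - p)` of the segment `[p, w]` (`0 ≤ t ≤ 1`) is `1`-porous at `p` against `T`:
`‖z - p‖ ≤ ‖q - z‖` for all `q ∈ T`. -/
theorem norm_sub_le_of_nearest {T : Set ℂ} {w p : ℂ} (hnear : ∀ q ∈ T, ‖p - w‖ ≤ ‖q - w‖)
    {t : ℝ} (ht0 : 0 ≤ t) (ht1 : t ≤ 1) {q : ℂ} (hq : q ∈ T) :
    ‖(p + t * (w - p)) - p‖ ≤ ‖q - (p + t * (w - p))‖ := by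
  have hz : (p + t * (w - p)) - p = (t : ℂ) * (w - p) := by ring
  have hzw : q - (p + t * (w - p)) = (q - w) + ((1 - t : ℝ) : ℂ) * (w - p) := by
    push_cast
    ring
  rw [hz, hzw]
  have h1 : ‖(t : ℂ) * (w - p)‖ = t * ‖w - p‖ := by
    rw [norm_mul, Complex.norm_real, Real.norm_of_nonneg ht0]
  have h2 : ‖((1 - t : ℝ) : ℂ) * (w - p)‖ = (1 - t) * ‖w - p‖ := by
    rw [norm_mul, Complex.norm_real, Real.norm_of_nonneg (by linarith)]
  have h3 : ‖q - w‖ ≤ ‖(q - w) + ((1 - t : ℝ) : ℂ) * (w - p)‖ + ‖((1 - t : ℝ) : ℂ) * (w - p)‖ := by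
    have := norm_sub_le ((q - w) + ((1 - t : ℝ) : ℂ) * (w - p)) (((1 - t : ℝ) : ℂ) * (w - p))
    simpa using this
  have h4 := hnear q hq
  rw [norm_sub_rev p w] at h4
  rw [h1]
  linarith

/-- For `0 < t ≤ 1` and `p ≠ w`, the point `p + t (w - p)` lies in the open ball `ball w ‖p - w‖`. -/
theorem mem_ball_of_pos {w p : ℂ} (hpw : p ≠ w) {t : ℝ} (ht0 : 0 < t) (ht1 : t ≤ 1) :
    p + t * (w - p) ∈ ball w ‖p - w‖ := by
  rw [mem_ball, dist_eq_norm]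
  have hz : (p + t * (w - p)) - w = ((1 - t : ℝ) : ℂ) * (p - w) := by
    push_cast
    ring
  rw [hz, norm_mul, Complex.norm_real, Real.norm_of_nonneg (by linarith)]
  have hpos : 0 < ‖p - w‖ := norm_pos_iff.2 (sub_ne_zero.2 hpw)
  nlinarith

/-- A ball around a point of `Ω₀(h)` that misses the wall and stays in `𝔻` lies in `Ω₀(h)`. -/
theorem ball_subset_originComponent {h : ℝ} {w : ℂ} (hw : w ∈ originComponent h) {d : ℝ}
    (hdT : Disjoint (ball w d) (closure (aliasedPoleSet h))) (hd1 : ball w d ⊆ ball (0 : ℂ) 1) :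
    ball w d ⊆ originComponent h := by
  by_cases hd : 0 < d
  · have hsub : ball w d ⊆ ball (0 : ℂ) 1 \ closure (aliasedPoleSet h) :=
      fun z hz ↦ ⟨hd1 hz, fun hzT ↦ (Set.disjoint_left.1 hdT) hz hzT⟩
    unfold originComponent at hw ⊢
    rw [connectedComponentIn_eq hw]
    exact (convex_ball w d).isPreconnected.subset_connectedComponentIn (mem_ball_self hd) hsub
  · rw [Metric.ball_eq_empty.2 (not_lt.1 hd)]
    exact empty_subset _

/-- **Porous access from a nearest point.**  If `w ∈ Ω₀(h)` has a nearest wall point `p ∈ T_h`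
(`infDist w T_h = dist w p`) and is closer to the wall than to the unit circle (`dist w p < 1 - ‖w‖`), then
`p ∈ 𝔻` and `p` is `1`-porously accessible from `Ω₀(h)`: some sequence `z_n → p` of points of `Ω₀(h)` has
`‖z_n - p‖ ≤ ‖q - z_n‖` for every `q ∈ T_h`. -/
theorem exists_porous_access_of_nearest {h : ℝ} {w p : ℂ} (hw : w ∈ originComponent h)
    (hp : p ∈ closure (aliasedPoleSet h)) (hd : infDist w (closure (aliasedPoleSet h)) = dist w p)
    (hd1 : dist w p < 1 - ‖w‖) :
    ‖p‖ < 1 ∧ ∃ z : ℕ → ℂ, Tendsto z atTop (𝓝 p) ∧ (∀ n, z n ∈ originComponent h) ∧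
      ∀ n, ∀ q ∈ closure (aliasedPoleSet h), ‖z n - p‖ ≤ ‖q - z n‖ := by
  have hwT : w ∉ closure (aliasedPoleSet h) := (originComponent_subset h hw).2
  have hpw : p ≠ w := fun hpw ↦ hwT (hpw ▸ hp)
  have hnear : ∀ q ∈ closure (aliasedPoleSet h), ‖p - w‖ ≤ ‖q - w‖ := by
    intro q hq
    rw [← dist_eq_norm, ← dist_eq_norm, dist_comm p w, dist_comm q w, ← hd]
    exact infDist_le_dist_of_mem hq
  have hball1 : ball w ‖p - w‖ ⊆ ball (0 : ℂ) 1 := by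
    intro z hz
    rw [mem_ball, dist_eq_norm] at hz
    rw [mem_ball_zero_iff]
    have h1 : ‖z‖ ≤ ‖z - w‖ + ‖w‖ := by
      have := norm_add_le (z - w) w
      simpa using this
    have h2 : ‖p - w‖ = dist w p := by rw [dist_comm, dist_eq_norm]
    linarith
  have hballT : Disjoint (ball w ‖p - w‖) (closure (aliasedPoleSet h)) := by
    have h2 : ‖p - w‖ = infDist w (closure (aliasedPoleSet h)) := by
      rw [hd, dist_comm, dist_eq_norm]
    rw [h2]
    exact disjoint_ball_infDist
  have hballΩ : ball w ‖p - w‖ ⊆ originComponent h := ball_subset_originComponent hw hballT hball1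
  refine ⟨?_, ?_⟩
  · -- `p ∈ 𝔻`: `‖p‖ ≤ ‖p - w‖ + ‖w‖ = dist w p + ‖w‖ < 1`
    have h1 : ‖p‖ ≤ ‖p - w‖ + ‖w‖ := by
      have := norm_add_le (p - w) w
      simpa using this
    have h2 : ‖p - w‖ = dist w p := by rw [dist_comm, dist_eq_norm]
    linarith
  -- the sequence `z_n = p + t_n (w - p)` on the segment `[p, w]`, `t_n → 0⁺`
  obtain ⟨t, ht0, ht1, htend⟩ := exists_seq_tendsto_zero
  refine ⟨fun n ↦ p + (t n : ℂ) * (w - p), ?_, fun n ↦ hballΩ (mem_ball_of_pos hpw (ht0 n) (ht1 n)),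
    fun n q hq ↦ norm_sub_le_of_nearest hnear (ht0 n).le (ht1 n) hq⟩
  -- `z_n → p`
  have := ((tendsto_ofReal_of_tendsto_zero htend).mul_const (w - p)).const_add p
  simpa using this

/-- **Nearest wall points are dense in the visible wall.**  For every point `x ∈ T_h ∩ 𝔻` adherent to
`Ω₀(h)` and every `r > 0` there are `w ∈ Ω₀(h)` and a nearest wall point `p ∈ T_h` of `w` with
`‖p - x‖ < r` and `dist w p < 1 - ‖w‖` (so `exists_porous_access_of_nearest` applies to `p`). -/
theorem exists_nearest_near {h : ℝ} {x : ℂ} (hxT : x ∈ closure (aliasedPoleSet h))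
    (hxΩ : x ∈ closure (originComponent h)) (hx1 : ‖x‖ < 1) {r : ℝ} (hr : 0 < r) :
    ∃ w ∈ originComponent h, ∃ p ∈ closure (aliasedPoleSet h),
      infDist w (closure (aliasedPoleSet h)) = dist w p ∧ dist w p < 1 - ‖w‖ ∧ ‖p - x‖ < r := by
  set s : ℝ := min r (1 - ‖x‖) / 2 with hs
  have hs0 : 0 < s := by
    rw [hs]
    have := lt_min hr (sub_pos.2 hx1)
    linarith
  have hsr : 2 * s ≤ r := by rw [hs]; linarith [min_le_left r (1 - ‖x‖)]
  have hs1 : 2 * s ≤ 1 - ‖x‖ := by rw [hs]; linarith [min_le_right r (1 - ‖x‖)]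
  obtain ⟨w, hw, hxw⟩ := Metric.mem_closure_iff.1 hxΩ s hs0
  obtain ⟨p, hp, hd⟩ :=
    (isClosed_closure (s := aliasedPoleSet h)).exists_infDist_eq_dist ⟨x, hxT⟩ w
  have hdp : dist w p < s := by
    rw [← hd]
    exact (infDist_le_dist_of_mem hxT).trans_lt (by rwa [dist_comm] at hxw)
  have hwx : ‖w - x‖ < s := by rwa [dist_comm, dist_eq_norm] at hxw
  refine ⟨w, hw, p, hp, hd, ?_, ?_⟩
  · -- `dist w p + ‖w‖ < s + (‖x‖ + s) ≤ 1`
    have h1 : ‖w‖ ≤ ‖w - x‖ + ‖x‖ := by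
      have := norm_add_le (w - x) x
      simpa using this
    linarith
  · have h1 : ‖p - x‖ ≤ ‖p - w‖ + ‖w - x‖ := by
      have := norm_add_le (p - w) (w - x)
      simpa using this
    have h2 : ‖p - w‖ = dist w p := by rw [dist_comm, dist_eq_norm]
    linarith

/-- **The wall is visible from the origin** (CEIL-free, RH-free, `h ≥ 0`).  If the aliased pole field is
non-empty, some wall point inside `𝔻` is adherent to `Ω₀(h)`: the open set `Ω₀(h)` misses the poles, so it
is a proper subset of the connected disc and cannot also be relatively closed in it; a boundary point of
`Ω₀(h)` inside `𝔻` off the wall would be swallowed by `Ω₀(h)` (small ball argument), so it lies on the wall. -/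
theorem exists_visible_wall_point {h : ℝ} (hh : 0 ≤ h) (hne : (aliasedPoleSet h).Nonempty) :
    ∃ x ∈ closure (aliasedPoleSet h), x ∈ closure (originComponent h) ∧ ‖x‖ < 1 := by
  obtain ⟨a, ha⟩ := hne
  have ha1 : ‖a‖ < 1 := ha.1
  have haT : a ∈ closure (aliasedPoleSet h) := subset_closure ha
  by_contra H
  push Not at H
  -- `u = Ω₀(h)` and `v = (closure Ω₀(h))ᶜ` disconnect the disc
  set F : Set ℂ := ball (0 : ℂ) 1 \ closure (aliasedPoleSet h) with hF
  have hFopen : IsOpen F := isOpen_ball.sdiff isClosed_closure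
  have hΩopen : IsOpen (originComponent h) := hFopen.connectedComponentIn
  have hcover : ball (0 : ℂ) 1 ⊆ originComponent h ∪ (closure (originComponent h))ᶜ := by
    intro z hz
    by_cases hzc : z ∈ closure (originComponent h)
    · refine Or.inl ?_
      have hzT : z ∉ closure (aliasedPoleSet h) := fun hzT ↦
        absurd (mem_ball_zero_iff.1 hz) (not_lt.2 (H z hzT hzc))
      have hzF : z ∈ F := ⟨hz, hzT⟩
      obtain ⟨δ, hδ, hδF⟩ := Metric.isOpen_iff.1 hFopen z hzF
      obtain ⟨y, hy, hzy⟩ := Metric.mem_closure_iff.1 hzc δ hδ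
      have hyb : y ∈ ball z δ := by rw [mem_ball, dist_comm]; exact hzy
      have hsub : ball z δ ⊆ connectedComponentIn F y :=
        (convex_ball z δ).isPreconnected.subset_connectedComponentIn hyb hδF
      have hy' : y ∈ connectedComponentIn F 0 := hy
      have heq : connectedComponentIn F 0 = connectedComponentIn F y := connectedComponentIn_eq hy'
      show z ∈ connectedComponentIn F 0
      rw [heq]
      exact hsub (mem_ball_self hδ)
    · exact Or.inr hzc
  have hu : (ball (0 : ℂ) 1 ∩ originComponent h).Nonempty :=
    ⟨0, mem_ball_self one_pos, zero_mem_originComponent hh⟩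
  have hv : (ball (0 : ℂ) 1 ∩ (closure (originComponent h))ᶜ).Nonempty := by
    refine ⟨a, mem_ball_zero_iff.2 ha1, fun hac ↦ ?_⟩
    exact absurd ha1 (not_lt.2 (H a haT hac))
  obtain ⟨z, -, hzΩ, hzc⟩ := (convex_ball (0 : ℂ) 1).isPreconnected _ _ hΩopen
    isClosed_closure.isOpen_compl hcover hu hv
  exact hzc (subset_closure hzΩ)

/-- **Some wall point is porously accessible** (CEIL-free, RH-free, `h ≥ 0`).  If the aliased pole field
`A_h` is non-empty, then some point `p` of the wall `T_h` inside `𝔻` is `1`-porously accessible from the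
origin's component: `z_n → p`, `z_n ∈ Ω₀(h)`, `‖z_n - p‖ ≤ ‖q - z_n‖` for all `q ∈ T_h`.  (Whether such a
`p` can be taken to be a POLE is exactly the zero-side conjunct `PorousPole` of route X-12.) -/
theorem exists_porous_wall_point {h : ℝ} (hh : 0 ≤ h) (hne : (aliasedPoleSet h).Nonempty) :
    ∃ p ∈ closure (aliasedPoleSet h), ‖p‖ < 1 ∧ ∃ z : ℕ → ℂ, Tendsto z atTop (𝓝 p) ∧
      (∀ n, z n ∈ originComponent h) ∧ ∀ n, ∀ q ∈ closure (aliasedPoleSet h), ‖z n - p‖ ≤ ‖q - z n‖ := by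
  obtain ⟨x, hxT, hxΩ, hx1⟩ := exists_visible_wall_point hh hne
  obtain ⟨w, hw, p, hp, hd, hd1, -⟩ := exists_nearest_near hxT hxΩ hx1 one_pos
  obtain ⟨hp1, z, hz, hzΩ, hpor⟩ := exists_porous_access_of_nearest hw hp hd hd1
  exact ⟨p, hp, hp1, z, hz, hzΩ, hpor⟩

/-! ## 2. The porous skin theorem under `CEIL(h)` -/

/-- **No `1`-porous access to an aliased pole** (`h > 0`, RH-free): under `CEIL(h)`, no sequence `z_n → p`
of points of `Ω₀(h)` with `‖z_n - p‖ ≤ ‖q - z_n‖` for all wall points `q ∈ T_h` converges to an aliased pole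
`p`.  This is the ζ-free kernel `ScrewBorelPorous.false_of_porous_access` (landed for item `NoPorousPole`)
fed with the tree dictionary (`summable_norm_coeff`, `re_coeff_neg`, `mult_ne_zero`,
`differentiableOn_latticeGF`, `latticeGF_eq_borel`) and `V = Ω₀(h)`; cf.
`ScrewLatticePorous.false_of_porous_access_of_latticeCeiling` (same content, route cone). -/
theorem false_of_porous_access_closure {h : ℝ} (hh : 0 < h) (hceil : LatticeCeiling h)
    {p : ℂ} (hp : p ∈ aliasedPoleSet h) {z : ℕ → ℂ} (hz : Tendsto z atTop (𝓝 p))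
    (hzΩ : ∀ n, z n ∈ originComponent h)
    (hpor : ∀ n, ∀ q ∈ closure (aliasedPoleSet h), ‖z n - p‖ ≤ ‖q - z n‖) : False :=
  ScrewBorelPorous.false_of_porous_access (c := coeff) (u := mult h) (V := originComponent h)
    summable_norm_coeff re_coeff_neg (mult_ne_zero h) (differentiableOn_latticeGF hceil)
    (Real.exp_pos (-(h / 2))) (fun _ hz ↦ latticeGF_eq_borel hh (mem_ball_zero_iff.1 hz))
    (isPreconnected_originComponent h) (zero_mem_originComponent hh.le) (originComponent_subset h)
    hp one_pos hz hzΩ fun n q hq _ ↦ by rw [one_mul]; exact hpor n q (subset_closure hq)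

/-- **POROUS SKIN THEOREM** (`h > 0`, RH-free).  Under `CEIL(h)`, no aliased pole is a nearest wall point:
for every `w ∈ Ω₀(h)` closer to the wall than to the unit circle (`infDist w T_h < 1 - ‖w‖`) and every
aliased pole `p`, `infDist w T_h < dist w p`.  (Otherwise `p` would be `1`-porously accessible from `Ω₀(h)`
along `[p, w]`, against `false_of_porous_access_closure`.) -/
theorem infDist_lt_dist_of_mem_aliasedPoleSet {h : ℝ} (hh : 0 < h) (hceil : LatticeCeiling h)
    {w : ℂ} (hw : w ∈ originComponent h) (hw1 : infDist w (closure (aliasedPoleSet h)) < 1 - ‖w‖)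
    {p : ℂ} (hp : p ∈ aliasedPoleSet h) : infDist w (closure (aliasedPoleSet h)) < dist w p := by
  by_contra H
  have hd : infDist w (closure (aliasedPoleSet h)) = dist w p :=
    le_antisymm (infDist_le_dist_of_mem (subset_closure hp)) (not_lt.1 H)
  obtain ⟨-, z, hz, hzΩ, hpor⟩ :=
    exists_porous_access_of_nearest hw (subset_closure hp) hd (hd ▸ hw1)
  exact false_of_porous_access_closure hh hceil hp hz hzΩ hpor

/-- **Non-pole limit points are dense in the visible wall** (`h > 0`, RH-free).  Under `CEIL(h)`: for every
wall point `x ∈ T_h ∩ 𝔻` adherent to `Ω₀(h)` and every `r > 0`, within `r` of `x` there is a point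
`p ∈ T_h ∖ A_h` inside `𝔻` — a limit point of aliased zeros which is NOT an aliased zero — that is
`1`-porously accessible from `Ω₀(h)`. -/
theorem exists_nonpole_near_of_latticeCeiling {h : ℝ} (hh : 0 < h) (hceil : LatticeCeiling h)
    {x : ℂ} (hxT : x ∈ closure (aliasedPoleSet h)) (hxΩ : x ∈ closure (originComponent h))
    (hx1 : ‖x‖ < 1) {r : ℝ} (hr : 0 < r) :
    ∃ p ∈ closure (aliasedPoleSet h), p ∉ aliasedPoleSet h ∧ ‖p - x‖ < r ∧ ‖p‖ < 1 ∧
      ∃ z : ℕ → ℂ, Tendsto z atTop (𝓝 p) ∧ (∀ n, z n ∈ originComponent h) ∧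
        ∀ n, ∀ q ∈ closure (aliasedPoleSet h), ‖z n - p‖ ≤ ‖q - z n‖ := by
  obtain ⟨w, hw, p, hp, hd, hd1, hpx⟩ := exists_nearest_near hxT hxΩ hx1 hr
  obtain ⟨hp1, z, hz, hzΩ, hpor⟩ := exists_porous_access_of_nearest hw hp hd hd1
  refine ⟨p, hp, fun hpA ↦ ?_, hpx, hp1, z, hz, hzΩ, hpor⟩
  have := infDist_lt_dist_of_mem_aliasedPoleSet hh hceil hw (hd ▸ hd1) hpA
  rw [hd] at this
  exact lt_irrefl _ this

/-- **THE DICHOTOMY, POROUS-SKIN FORM** (`h > 0`, RH-free).  If the lattice samples `Ψ(k h)` grow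
sub-exponentially (`CEIL(h)`), then EITHER the Riemann hypothesis holds OR the wall `T_h` contains, inside
`𝔻`, a limit point of aliased far zeros which is not itself an aliased far zero and which is `1`-porously
accessible from the origin's component `Ω₀(h)`.  (No new survivor row: the negation of the second
alternative for a non-empty field makes the visible wall consist of poles, hence countable, which implies
`CC(h)` — row X-9.) -/
theorem latticeCeiling_dichotomy_skin {h : ℝ} (hh : 0 < h) (hceil : LatticeCeiling h) :
    RiemannHypothesis ∨ ∃ p ∈ closure (aliasedPoleSet h), p ∉ aliasedPoleSet h ∧ ‖p‖ < 1 ∧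
      ∃ z : ℕ → ℂ, Tendsto z atTop (𝓝 p) ∧ (∀ n, z n ∈ originComponent h) ∧
        ∀ n, ∀ q ∈ closure (aliasedPoleSet h), ‖z n - p‖ ≤ ‖q - z n‖ := by
  by_cases hRH : RiemannHypothesis
  · exact Or.inl hRH
  · obtain ⟨x, hxT, hxΩ, hx1⟩ :=
      exists_visible_wall_point hh.le (aliasedPoleSet_nonempty_of_not_rh hh hRH)
    obtain ⟨p, hp, hpA, -, hp1, z, hz, hzΩ, hpor⟩ :=
      exists_nonpole_near_of_latticeCeiling hh hceil hxT hxΩ hx1 one_pos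
    exact Or.inr ⟨p, hp, hpA, hp1, z, hz, hzΩ, hpor⟩

/-- **Under `CEIL(h)` and `¬RH` the aliased far zeros ACCUMULATE inside the open disc at non-poles**
(`h > 0`): the wall has a point of `(T_h ∖ A_h) ∩ 𝔻`. -/
theorem exists_mem_closure_diff_of_not_rh {h : ℝ} (hh : 0 < h) (hceil : LatticeCeiling h)
    (hRH : ¬ RiemannHypothesis) :
    ∃ p ∈ closure (aliasedPoleSet h) \ aliasedPoleSet h, ‖p‖ < 1 := by
  rcases latticeCeiling_dichotomy_skin hh hceil with h1 | ⟨p, hp, hpA, hp1, -⟩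
  · exact absurd h1 hRH
  · exact ⟨p, ⟨hp, hpA⟩, hp1⟩

/-! ## 3. Placement: `CC(h)` gives a porously accessible POLE (`X-9 ⊆ X-12`) -/

/-- **`CC(h)` ⟹ a porously accessible pole** (`h ≥ 0`, RH-free).  If the closure of the aliased pole field
is countable inside `𝔻` and the field is non-empty, then some aliased pole `p` is `1`-porously accessible from
`Ω₀(h)`: Baire gives a pole isolated in the wall (`ScrewBorel.exists_isolated_pole`), `𝔻 ∖ T_h` is
path-connected (`ScrewBorel.isPathConnected_ball_diff`) so equals `Ω₀(h)`, and the points `p + ε/(2(n+1))`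
do the job. -/
theorem exists_porous_pole_of_countableClosure {h : ℝ} (hh : 0 ≤ h) (hcc : CountableClosure h)
    (hne : (aliasedPoleSet h).Nonempty) :
    ∃ p ∈ aliasedPoleSet h, ∃ z : ℕ → ℂ, Tendsto z atTop (𝓝 p) ∧ (∀ n, z n ∈ originComponent h) ∧
      ∀ n, ∀ q ∈ closure (aliasedPoleSet h), q ≠ p → ‖z n - p‖ ≤ ‖q - z n‖ := by
  have hcount : (closure (aliasedPoleSet h) ∩ ball (0 : ℂ) 1).Countable := hcc
  obtain ⟨p, hp, ε, hε, hpε, hiso⟩ := exists_isolated_pole (u := mult h) hne hcount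
  -- `Ω₀(h) = 𝔻 ∖ T_h`
  have hΩ : ball (0 : ℂ) 1 \ closure (aliasedPoleSet h) ⊆ originComponent h :=
    (isPathConnected_ball_diff hcount).isConnected.isPreconnected.subset_connectedComponentIn
      (zero_mem_ball_diff_closure hh) Subset.rfl
  obtain ⟨t, ht0, ht1, htend⟩ := exists_seq_tendsto_zero
  -- `z_n = p + ε t_n / 2`, `‖z_n - p‖ = ε t_n / 2 ∈ (0, ε/2]`
  have hnorm : ∀ n, ‖(p + ((ε / 2 * t n : ℝ) : ℂ)) - p‖ = ε / 2 * t n := fun n ↦ by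
    rw [add_sub_cancel_left, Complex.norm_real, Real.norm_of_nonneg (mul_pos (half_pos hε) (ht0 n)).le]
  refine ⟨p, hp, fun n ↦ p + ((ε / 2 * t n : ℝ) : ℂ), ?_, fun n ↦ hΩ ⟨?_, fun hzT ↦ ?_⟩, ?_⟩
  · -- `z_n → p`
    have h0 : Tendsto (fun n ↦ ε / 2 * t n) atTop (𝓝 0) := by
      simpa using htend.const_mul (ε / 2)
    have := (tendsto_ofReal_of_tendsto_zero h0).const_add p
    simpa using this
  · -- `z_n ∈ 𝔻`: `‖z_n‖ ≤ ‖p‖ + ε/2 < 1`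
    rw [mem_ball_zero_iff]
    have h1 : ‖p + ((ε / 2 * t n : ℝ) : ℂ)‖ ≤ ‖p‖ + ε / 2 * t n := by
      have := norm_add_le p (((ε / 2 * t n : ℝ) : ℂ))
      rwa [Complex.norm_real, Real.norm_of_nonneg (mul_pos (half_pos hε) (ht0 n)).le] at this
    have h2 : ε / 2 * t n ≤ ε / 2 := by nlinarith [ht1 n, hε]
    linarith
  · -- `z_n ∉ T_h`: it is within `2ε` of the isolated pole `p` and `≠ p`
    have h1 : ‖(p + ((ε / 2 * t n : ℝ) : ℂ)) - p‖ < 2 * ε := by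
      rw [hnorm n]; nlinarith [ht1 n, hε]
    have hzT' : p + ((ε / 2 * t n : ℝ) : ℂ) ∈ closure (aliasedPoleSet h) := hzT
    have h2 : p + ((ε / 2 * t n : ℝ) : ℂ) = p := hiso _ hzT' h1
    have h3 : ε / 2 * t n = 0 := by
      have := hnorm n
      rw [h2, sub_self, norm_zero] at this
      linarith
    have := ht0 n
    nlinarith [hε]
  · -- porosity: `‖q - p‖ ≥ 2ε` for wall points `q ≠ p`
    intro n q hq hqp
    have hfar : 2 * ε ≤ ‖q - p‖ := by
      by_contra hlt
      exact hqp (hiso q hq (not_le.1 hlt))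
    have h1 : ‖q - p‖ ≤ ‖q - (p + ((ε / 2 * t n : ℝ) : ℂ))‖ + ‖(p + ((ε / 2 * t n : ℝ) : ℂ)) - p‖ :=
      norm_sub_le_norm_sub_add_norm_sub _ _ _
    rw [hnorm n] at h1 ⊢
    have h2 : ε / 2 * t n ≤ ε / 2 := by nlinarith [ht1 n, hε]
    linarith

/-- **PLACEMENT `X-9 ⊆ X-12`** (RH-free): `CC(1)` implies the zero-side conjunct `PorousPole` of route
`ScrewPorousWall` (with porosity constant `κ = 1`).  The conclusion is the BODY of the route decl
`Theses.ScrewPorousWall.PorousPole` with its hypothesis `(aliasedPoleSet 1).Nonempty` as an argument, so that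
`fun hne ↦ porous_pole_of_countableClosure_one hcc hne : Theses.ScrewPorousWall.PorousPole` by unfolding;
it is stated unfolded on purpose — no by-name claim is made on the OPEN item `PorousPole`, which is NOT
proved here (only derived from the open conjecture `CC(1)`), and no `Theses` module is imported. -/
theorem porous_pole_of_countableClosure_one (hcc : CountableClosure 1)
    (hne : (aliasedPoleSet 1).Nonempty) :
    ∃ p ∈ aliasedPoleSet 1, ∃ κ : ℝ, 0 < κ ∧ ∃ z : ℕ → ℂ, Tendsto z atTop (𝓝 p) ∧
      (∀ n, z n ∈ connectedComponentIn (ball (0 : ℂ) 1 \ closure (aliasedPoleSet 1)) 0) ∧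
      (∀ n, ∀ q ∈ closure (aliasedPoleSet 1), q ≠ p → κ * ‖z n - p‖ ≤ ‖q - z n‖) := by
  obtain ⟨p, hp, z, hz, hzΩ, hpor⟩ := exists_porous_pole_of_countableClosure zero_le_one hcc hne
  exact ⟨p, hp, 1, one_pos, z, hz, hzΩ, fun n q hq hqp ↦ by rw [one_mul]; exact hpor n q hq hqp⟩

end Summit.RiemannHypothesis.RiemannHypothesis.Theorems.Splittings.ScrewPorousSkin
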